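import Summits.Ventures.PercRepro.C025ProfileThinGirthC
import Summits.Ventures.PercRepro.C025ProfileThinTriangleC

/-!
# THE ROW `(q, q+1)` ON THIN MATROIDS WITH A `g`-CIRCUIT — part D: THE ROW FOR ANY WEIGHTS (night-3 g15)
The `g`-circuit generalisation of `C025ProfileThinTriangleD` (parts A–C = `C025ProfileThinGirthA/B/C`).
`profileIneq_thinGirth_of_weights`: in a finite matroid of girth `≥ g ≥ 3` with a `g`-circuit `C₀` (written `K`), in which every
rank-`q` set has `≤ q + 1` points (`g ≤ q`), the row `(q, q+1)` and its Hall form follow from ANY type weights `a b : ℕ → ℚ`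
(`a t` on `B ∪ {x}` with `x ∉ C₀`, `b t` with `x ∈ C₀`, `t = |B ∩ C₀| ≤ g − 1`), `s_Q` (the top type on the `(q+2)`-sets `⊇ C₀`) and `σ`
(the uniform inner payment) satisfying, with `f = |E| − q − 1 ≥ q`: (Dem) `(g − t) b_t + (f + 1 − (g − t)) a_t ≥ f + 1` for `1 ≤ t ≤ g − 2`,
`g b_0 + (f + 1 − g) a_0 ≥ f`, `f (a_{g−1} + s_Q) ≥ f + 1`, `a_t, b_t ≤ f σ` for `t ≤ g − 2`; (Cap) `s b_{s−1} + (q + 1 − s) a_s ≤ q + 1`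
for `s ≤ g − 1`, `(q + 2 − g) + g (q + 2 − g) s_Q ≤ q + 1`, `c + c (q + 2 − c) σ ≤ q + 1` for `c ≤ g − 1`; all weights `≥ 0`.
The weight is an explicit sum of four indicator terms (type a, the `(q+1)`-sets by `|S ∩ C₀| = |B ∩ C₀| + 1` or not, the top type on
`(q+2)`-sets `⊇ C₀`, the σ-term on `(q+2)`-sets with an inner point of `B`). The triangle chain is the case `g = 3`.
-/
open scoped Matroid
namespace PercRepro
open Set Finset ThmH Staged
namespace ThinGirth
variable {α : Type} [DecidableEq α] {M : Matroid α} [M.Finite]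

/-- **THE ROW `(q, q+1)` AND ITS HALL FORM FOR ANY WEIGHTS** satisfying the `g`-cascade (Dem) / (Cap) arithmetic. -/
theorem profileIneq_thinGirth_of_weights (q g : ℕ) (hg3 : 3 ≤ g) (hgq : g ≤ q)
    (hgirth : ∀ X ⊆ gr M, X.card + 1 ≤ g → rkN M X = X.card)
    (hthin : ∀ X ⊆ gr M, rkN M X = q → X.card ≤ q + 1)
    (K : Finset α) (hKg : K ⊆ gr M) (hK3 : K.card = g) (hKrk : rkN M K + 1 = g)
    (a b : ℕ → ℚ) (sQ σ : ℚ) (ha : ∀ t, 0 ≤ a t) (hb : ∀ t, 0 ≤ b t) (hsQ : 0 ≤ sQ) (hσ : 0 ≤ σ)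
    (hfq : q ≤ (gr M).card - q - 1)
    (hdem : ∀ t : ℕ, 1 ≤ t → t + 2 ≤ g → (((gr M).card - q - 1 : ℕ) : ℚ) + 1 ≤
      ((g - t : ℕ) : ℚ) * b t + (((gr M).card - q - g + t : ℕ) : ℚ) * a t)
    (hdem0 : (((gr M).card - q - 1 : ℕ) : ℚ) ≤ (g : ℚ) * b 0 + (((gr M).card - q - g : ℕ) : ℚ) * a 0)
    (hdemtop : (((gr M).card - q - 1 : ℕ) : ℚ) + 1 ≤ (((gr M).card - q - 1 : ℕ) : ℚ) * (a (g - 1) + sQ))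
    (hσab : ∀ t : ℕ, t + 2 ≤ g → a t ≤ (((gr M).card - q - 1 : ℕ) : ℚ) * σ ∧ b t ≤ (((gr M).card - q - 1 : ℕ) : ℚ) * σ)
    (hcap : ∀ s : ℕ, s + 1 ≤ g → (s : ℚ) * b (s - 1) + ((q + 1 - s : ℕ) : ℚ) * a s ≤ q + 1)
    (hcapQ : ((q + 2 - g : ℕ) : ℚ) + ((g * (q + 2 - g) : ℕ) : ℚ) * sQ ≤ q + 1)
    (hcapiii : ∀ c : ℕ, c + 1 ≤ g → (c : ℚ) + ((c * (q + 2 - c) : ℕ) : ℚ) * σ ≤ q + 1) :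
    Profile.ProfileIneq M q (q + 1) ∧ Profile.HallIneq M q (q + 1) := by
  let w : Finset α → Finset α → ℚ := fun B S =>
    (if B.card = q + 1 ∧ S.card = q + 2 then (1 : ℚ) else 0) +
    (if B.card = q ∧ S.card = q + 1 then
      (if (S ∩ K).card = (B ∩ K).card + 1 ∧ (S ∩ K).card + 1 ≤ g then b (B ∩ K).card else a (B ∩ K).card) else 0) +
    (if B.card = q ∧ (B ∩ K).card + 1 = g ∧ S.card = q + 2 ∧ (S ∩ K).card = g then sQ else 0) +
    (if B.card = q ∧ (B ∩ K).card + 2 ≤ g ∧ S.card = q + 2 ∧ (∃ y ∈ S \ B, rkN M (insert y B) = q) then σ else 0)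
  have hw_nonneg : ∀ B S, 0 ≤ w B S := by
    intro B S
    simp only [w]
    repeat' apply add_nonneg
    all_goals split_ifs <;> first | assumption | exact ha _ | exact hb _ | norm_num
  -- evaluations of the weight
  have hw_a : ∀ B S : Finset α, B.card = q + 1 → S.card = q + 2 → w B S = 1 := by
    intro B S h1 h2
    simp only [w, if_pos (And.intro h1 h2), if_neg (show ¬(B.card = q ∧ S.card = q + 1) by omega),
      if_neg (show ¬(B.card = q ∧ (B ∩ K).card + 1 = g ∧ S.card = q + 2 ∧ (S ∩ K).card = g) by omega),
      if_neg (show ¬(B.card = q ∧ (B ∩ K).card + 2 ≤ g ∧ S.card = q + 2 ∧ (∃ y ∈ S \ B, rkN M (insert y B) = q)) from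
        fun h => by obtain ⟨h', -, -, -⟩ := h; omega),
      add_zero]
  have hw_a1 : ∀ B S : Finset α, B.card = q + 1 → S.card = q + 2 → w B S ≤ 1 :=
    fun B S h1 h2 => le_of_eq (hw_a B S h1 h2)
  have hw_succ : ∀ B S : Finset α, B.card = q → S.card = q + 1 →
      w B S = if (S ∩ K).card = (B ∩ K).card + 1 ∧ (S ∩ K).card + 1 ≤ g then b (B ∩ K).card else a (B ∩ K).card := by
    intro B S h1 h2
    simp only [w, if_neg (show ¬(B.card = q + 1 ∧ S.card = q + 2) by omega), if_pos (And.intro h1 h2),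
      if_neg (show ¬(B.card = q ∧ (B ∩ K).card + 1 = g ∧ S.card = q + 2 ∧ (S ∩ K).card = g) by omega),
      if_neg (show ¬(B.card = q ∧ (B ∩ K).card + 2 ≤ g ∧ S.card = q + 2 ∧ (∃ y ∈ S \ B, rkN M (insert y B) = q)) from
        fun h => by obtain ⟨-, -, h', -⟩ := h; omega),
      add_zero, zero_add]
  have hw_in : ∀ B S : Finset α, B.card = q → S.card = q + 1 → (S ∩ K).card = (B ∩ K).card + 1 →
      (S ∩ K).card + 1 ≤ g → w B S = b (B ∩ K).card := by
    intro B S h1 h2 h3 h4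
    rw [hw_succ B S h1 h2, if_pos ⟨h3, h4⟩]
  have hw_out : ∀ B S : Finset α, B.card = q → S.card = q + 1 → (S ∩ K).card = (B ∩ K).card →
      w B S = a (B ∩ K).card := by
    intro B S h1 h2 h3
    rw [hw_succ B S h1 h2, if_neg (fun h => by omega)]
  have hw_2Q : ∀ B S : Finset α, B.card = q → (B ∩ K).card + 1 = g → S.card = q + 2 → (S ∩ K).card = g →
      w B S = sQ := by
    intro B S h1 h2 h3 h4
    simp only [w, if_neg (show ¬(B.card = q + 1 ∧ S.card = q + 2) by omega),
      if_neg (show ¬(B.card = q ∧ S.card = q + 1) by omega), if_pos (And.intro h1 (And.intro h2 (And.intro h3 h4))),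
      if_neg (show ¬(B.card = q ∧ (B ∩ K).card + 2 ≤ g ∧ S.card = q + 2 ∧ (∃ y ∈ S \ B, rkN M (insert y B) = q)) from
        fun h => by obtain ⟨-, h', -, -⟩ := h; omega),
      add_zero, zero_add]
  have hw_2Q0 : ∀ B S : Finset α, B.card = q → (B ∩ K).card + 1 = g → S.card = q + 2 → (S ∩ K).card ≠ g →
      w B S = 0 := by
    intro B S h1 h2 h3 h4
    simp only [w, if_neg (show ¬(B.card = q + 1 ∧ S.card = q + 2) by omega),
      if_neg (show ¬(B.card = q ∧ S.card = q + 1) by omega),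
      if_neg (show ¬(B.card = q ∧ (B ∩ K).card + 1 = g ∧ S.card = q + 2 ∧ (S ∩ K).card = g) by omega),
      if_neg (show ¬(B.card = q ∧ (B ∩ K).card + 2 ≤ g ∧ S.card = q + 2 ∧ (∃ y ∈ S \ B, rkN M (insert y B) = q)) from
        fun h => by obtain ⟨-, h', -, -⟩ := h; omega),
      add_zero]
  have hw_small_eq : ∀ B S : Finset α, B.card = q → (B ∩ K).card + 2 ≤ g → S.card = q + 2 →
      w B S = if (∃ y ∈ S \ B, rkN M (insert y B) = q) then σ else 0 := by
    intro B S h1 h2 h3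
    simp only [w, if_neg (show ¬(B.card = q + 1 ∧ S.card = q + 2) by omega),
      if_neg (show ¬(B.card = q ∧ S.card = q + 1) by omega),
      if_neg (show ¬(B.card = q ∧ (B ∩ K).card + 1 = g ∧ S.card = q + 2 ∧ (S ∩ K).card = g) by omega),
      zero_add]
    by_cases hex : ∃ y ∈ S \ B, rkN M (insert y B) = q
    · rw [if_pos ⟨h1, h2, h3, hex⟩, if_pos hex]
    · rw [if_neg (fun h => hex h.2.2.2), if_neg hex]
  have hw_q_small : ∀ B S : Finset α, B.card = q → (B ∩ K).card + 2 ≤ g → S.card = q + 2 →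
      w B S ≤ if (∃ y ∈ S \ B, rkN M (insert y B) = q) then σ else 0 :=
    fun B S h1 h2 h3 => le_of_eq (hw_small_eq B S h1 h2 h3)
  have hw_σ : ∀ B S : Finset α, B.card = q → (B ∩ K).card + 2 ≤ g → S.card = q + 2 →
      (∃ y ∈ S \ B, rkN M (insert y B) = q) → w B S = σ := by
    intro B S h1 h2 h3 hex
    rw [hw_small_eq B S h1 h2 h3, if_pos hex]
  have hw_big : ∀ B S : Finset α, q + 3 ≤ S.card → w B S = 0 := by
    intro B S h
    simp only [w, if_neg (show ¬(B.card = q + 1 ∧ S.card = q + 2) by omega),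
      if_neg (show ¬(B.card = q ∧ S.card = q + 1) by omega),
      if_neg (show ¬(B.card = q ∧ (B ∩ K).card + 1 = g ∧ S.card = q + 2 ∧ (S ∩ K).card = g) by omega),
      if_neg (show ¬(B.card = q ∧ (B ∩ K).card + 2 ≤ g ∧ S.card = q + 2 ∧ (∃ y ∈ S \ B, rkN M (insert y B) = q)) from
        fun h' => by obtain ⟨-, -, h'', -⟩ := h'; omega),
      add_zero]
  -- the type-`t` weights on `B ∪ {x}` as needed by parts B and C
  have hwa : ∀ t : ℕ, t + 2 ≤ g → ∀ B S : Finset α, B.card = q → (B ∩ K).card = t → S.card = q + 1 →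
      (S ∩ K).card = t + 1 → w B S = b t := by
    intro t ht B S h1 h2 h3 h4
    rw [hw_in B S h1 h3 (by omega) (by omega), h2]
  have hwb : ∀ t : ℕ, ∀ B S : Finset α, B.card = q → (B ∩ K).card = t → S.card = q + 1 →
      (S ∩ K).card = t → w B S = a t := by
    intro t B S h1 h2 h3 h4
    rw [hw_out B S h1 h3 (by omega), h2]
  have hw_topI : ∀ B S : Finset α, B.card = q → (B ∩ K).card + 1 = g → S.card = q + 1 → w B S = a (g - 1) := by
    intro B S h1 h2 h3
    rw [hw_succ B S h1 h3, if_neg (fun h => by omega)]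
    congr 1
    omega
  have hq1 : (0 : ℚ) < (q : ℚ) + 1 := by positivity
  -- (Cap)
  have hcapS : ∀ S ∈ Shadow.levelSet M (q + 1),
      ∑ B ∈ (Profile.Rq M q).filter (fun B => B ⊆ S), w B S / ((q : ℚ) + 1) ≤ 1 := by
    intro S hS
    rw [Profile.mem_levelSet] at hS
    obtain ⟨hSg, hSr⟩ := hS
    have hSq : rkN M S = q + 1 := rkN_eq_iff.mpr hSr
    rw [← Finset.sum_div, div_le_one hq1]
    have hSc : q + 1 ≤ S.card := hSq ▸ rkN_le_card S
    rcases (by omega : S.card = q + 1 ∨ S.card = q + 2 ∨ q + 3 ≤ S.card) with h1 | h2 | h3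
    · exact cap_succ hK3 hKrk w hw_nonneg a b hw_in hw_out hcap h1 hSq
    · by_cases hKS : K ⊆ S
      · exact cap_Q hgirth hthin hKg hK3 hKrk w sQ σ hsQ hw_a1 hw_2Q hw_q_small hcapQ h2 hSq hKS
      · exact cap_extra hgirth hthin hKg hK3 hKrk w σ hσ hcapiii hw_a1 hw_2Q0 hw_q_small hSg h2 hSq hKS
    · exact ThinTriangle.cap_big w hw_big h3
  -- (Dem)
  have hfg : g ≤ (gr M).card - q - 1 := by omega
  have hdemB : ∀ B ∈ Profile.Rq M q, Profile.price M q (q + 1) B ≤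
      ∑ S ∈ (Shadow.levelSet M (q + 1)).filter (fun S => B ⊆ S), w B S / ((q : ℚ) + 1) := by
    intro B hB
    rw [ThinRow.price_succ_eq]
    split_ifs with hd
    · rw [← Finset.sum_div]
      apply div_le_div_of_nonneg_right _ hq1.le
      rw [Profile.mem_Rq] at hB
      obtain ⟨hBg, hBr⟩ := hB
      have hBq : rkN M B = q := rkN_eq_iff.mpr hBr
      rcases ThinTriangle.card_eq_or_eq_of_rkN_eq hthin hBg hBq with hBc | hBc
      · have hm : (B ∩ K).card ≤ g := (Finset.card_le_card Finset.inter_subset_right).trans hK3.le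
        have hmg : (B ∩ K).card ≠ g := by
          intro h3
          have hKB : K ⊆ B := (subset_iff_card_inter_eq hK3).mpr h3
          have := rkN_add_one_le_card_of_subset hK3 hKrk hKB
          omega
        rcases (by omega : (B ∩ K).card + 1 = g ∨ (B ∩ K).card + 2 ≤ g) with htop | hlow
        · exact dem_top hKg hK3 hKrk hthin w hw_nonneg (a (g - 1)) sQ hw_topI hw_2Q hdemtop hBg hBc hBq htop
        · -- the lower types: the crude demand bounds
          set t := (B ∩ K).card with ht
          have hc1 : (crk M B : ℚ) ≤ (((gr M).card - q - 1 : ℕ) : ℚ) + 1 := by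
            have := OneCircuit.crk_add_card_le B hBg
            exact_mod_cast (by omega : crk M B ≤ (gr M).card - q - 1 + 1)
          have hc0 : t = 0 → (crk M B : ℚ) ≤ (((gr M).card - q - 1 : ℕ) : ℚ) := by
            intro h0
            have := crk_add_card_add_one_le hK3 hKrk hKg hBg h0
            exact_mod_cast (by omega : crk M B ≤ (gr M).card - q - 1)
          have hdemt : (((gr M).card - q - 1 : ℕ) : ℚ) + (if t = 0 then 0 else 1) ≤
              ((g - t : ℕ) : ℚ) * b t + (((gr M).card - q - g + t : ℕ) : ℚ) * a t := by
            split_ifs with h0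
            · rw [h0]
              simp only [Nat.sub_zero, add_zero]
              exact hdem0
            · exact hdem t (by omega) hlow
          have hcrk : (crk M B : ℚ) ≤ (((gr M).card - q - 1 : ℕ) : ℚ) + (if t = 0 then 0 else 1) := by
            split_ifs with h0
            · simpa using hc0 h0
            · exact hc1
          obtain ⟨hat, hbt⟩ := hσab t hlow
          by_cases hin : ∃ y ∈ gr M \ B, rkN M (insert y B) = q
          · obtain ⟨y, hy, hyr⟩ := hin
            have hyg : y ∈ gr M := (Finset.mem_sdiff.mp hy).1
            have hyB : y ∉ B := (Finset.mem_sdiff.mp hy).2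
            obtain ⟨j, hj1, hj2, hle⟩ := dem_small_inner hKg hK3 hthin w hw_nonneg (b t) (a t) σ (m := t) hlow
              (hwa t hlow) (hwb t) hw_σ hBg hBc hBq rfl hyg hyB hyr
            have hjcast : (((gr M).card - q - 1 - j : ℕ) : ℚ) = (((gr M).card - q - 1 : ℕ) : ℚ) - j := by
              rw [Nat.cast_sub (by omega)]
            have hgt : ((g - t : ℕ) : ℚ) = (g : ℚ) - t := by rw [Nat.cast_sub (by omega)]
            have hfgt : (((gr M).card - q - g + t : ℕ) : ℚ) = (((gr M).card - q - 1 : ℕ) : ℚ) + 1 - (g - t) := by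
              have e : (gr M).card - q - g + t = (gr M).card - q - 1 + 1 - (g - t) := by omega
              rw [e, Nat.cast_sub (by omega), Nat.cast_sub (by omega)]
              push_cast
              ring
            rw [hjcast] at hle
            rw [hgt, hfgt] at hdemt
            -- `j = g − t` or `j = g − t − 1`: the paid sum is the full demand minus one weight, plus `f σ`
            have hjq : (j : ℚ) = (g : ℚ) - t ∨ (j : ℚ) + 1 = (g : ℚ) - t := by
              rcases (by omega : j + t = g ∨ j + t + 1 = g) with h | h
              · left
                have : ((j : ℕ) : ℚ) = ((g - t : ℕ) : ℚ) := by rw [show g - t = j by omega]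
                rw [Nat.cast_sub (by omega)] at this
                exact this
              · right
                have : ((j + 1 : ℕ) : ℚ) = ((g - t : ℕ) : ℚ) := by rw [show g - t = j + 1 by omega]
                rw [Nat.cast_sub (by omega)] at this
                push_cast at this
                exact this
            rcases hjq with hj | hj
            · rw [hj] at hle
              linarith [hle, hdemt, hcrk, hat, hbt]
            · have hj' : (j : ℚ) = (g : ℚ) - t - 1 := by linarith
              rw [hj'] at hle
              linarith [hle, hdemt, hcrk, hat, hbt]
          · have hno : ∀ x ∈ gr M, x ∉ B → rkN M (insert x B) ≠ q :=
              fun x hx hxB h => hin ⟨x, Finset.mem_sdiff.mpr ⟨hx, hxB⟩, h⟩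
            have hs := dem_small hKg hK3 w hw_nonneg (b t) (a t) (m := t) (by omega) (hwa t hlow) (hwb t)
              hBg hBc hBq rfl hno
            have e : (gr M).card - q - (g - t) = (gr M).card - q - g + t := by omega
            rw [e] at hs
            linarith
      · exact ThinTriangle.dem_a hthin w hw_nonneg hw_a hBg hBc hBq
    · exact Finset.sum_nonneg (fun S _ => div_nonneg (hw_nonneg B S) hq1.le)
  exact ⟨profileIneq_of_cert q (q + 1) (fun B S => w B S / ((q : ℚ) + 1)) hcapS hdemB,
    hallIneq_of_cert q (q + 1) (fun B S => w B S / ((q : ℚ) + 1)) (fun B S => div_nonneg (hw_nonneg B S) hq1.le)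
      hcapS hdemB⟩

end ThinGirth
end PercRepro
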